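import Summits.SmoothPoincare4.SmoothPoincare4.Theorems.AgkCor6Sufficiency.Negative.StablyTrivialTight

/-!
# `AgkCor6Sufficiency` — negative-side support VI: no finite truncation of `X` is usable; normal form of a stable-triviality witness

Companion of `StablyTrivialTight.lean` / `DownwardClosed.lean` (crux item `stmt-SmoothPoincare4-10894`,
work file `Cruxes/AgkCor6Sufficiency/Disproof.lean` §9–§10).  The crux is `X → SmoothPoincare4`,
`X = ∀ k, X_k`, `X_k` = "every `(3k, k)` group trisection of the trivial group is stably trivial".

* §1 Truncations.  `X_{≤k₀} → SmoothPoincare4` is formally stronger than the crux and gets weaker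
  as `k₀` grows; at `k₀ = 0` the hypothesis is a theorem (`agkCondition_zero`: every genus-`0`
  triple is the trivial one), so the truncated crux IS the summit
  (`agkCor6SufficiencyUpTo_zero_iff_smoothPoincare4`).  Hence no proof of the crux gets by with
  finitely many levels of `X` unless it proves the summit outright, and (with `DownwardClosed`) no
  refutation comes from finitely many levels either.
* §2 Witness normal form.  In a witness `Iso (K.stabilizeIter n) ((s4Kernels.stabilizeIter m).cast h)`
  of stable triviality of a `(g, k)` trisection of any group, `m` is FORCED: `k + n = m + 1`
  (`eq_of_isStablyTrivial_witness`, rank of the pairwise quotients); so `IsStablyTrivial` has the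
  one-existential form `∃ n, 1 ≤ k + n ∧ Iso (K.stabilizeIter n) (std_{k+n-1}.cast _)`
  (`isStablyTrivial_iff_exists`).  (Stabilisation-invariance of the conclusion: the downward half
  is `isStablyTrivial_of_stabilizeIter` of `DownwardClosed.lean`; the upward half holds for
  witnesses with `n ≥ 1` by re-indexing — work file §10 — and for `n = 0` needs
  `Iso K K' → Iso K.stabilize K'.stabilize`, available in the tree only for liftable automorphisms,
  `Literature.Topology.FourManifolds.TrisectionKernels.Iso.stabilize_of_lift`, i.e. modulo
  Nielsen's lifting theorem — a named gap, not a mathematical one.)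
Nothing here concludes the crux or `X`.

References: A. Abrams, D. Gay, R. Kirby, *Group trisections and smooth 4-manifolds*, Geom. Topol.
22 (2018), Def. 3, Cor. 6 (p. 1541); J. Meier, T. Schirmer, A. Zupan, *Classification of
trisections and the generalized property R conjecture*, Proc. AMS 144 (2016) (the `(3;1,1,1)` case,
i.e. `X_1`, is the first type outside the classification).
-/

noncomputable section

namespace Summit.SmoothPoincare4.SmoothPoincare4.Theorems.AgkCor6Sufficiency.Negative

open Literature.Topology.FourManifolds Subgroup
open Summit.SmoothPoincare4.SmoothPoincare4.Theses.CongruenceShadows (AgkCor6Sufficiency)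

/-! ## 1. Truncations of AGK's condition -/

/-- AGK's condition holds at level `0` outright: every genus-`0` kernel triple is the trivial one,
which is stably trivial. [folklore] -/
theorem agkCondition_zero (K : TrisectionKernels (3 * 0))
    (_hK : IsGroupTrisection (3 * 0) 0 (PUnit : Type) K) : K.IsStablyTrivial := by
  obtain rfl : K = trivialKernels := K.eq_trivialKernels
  exact trivialKernels_isStablyTrivial

/-- **Each truncation `X_{≤k₀} → SmoothPoincare4` implies the crux** (recorded contrapositively: a
disproof of the crux disproves every truncation). [cite: AbramsGayKirby2018, Cor. 6 (p. 1541)] -/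
theorem not_agkCor6SufficiencyUpTo_of_not (k₀ : ℕ) (h : ¬ AgkCor6Sufficiency) :
    ¬ ((∀ k ≤ k₀, ∀ K : TrisectionKernels (3 * k),
        IsGroupTrisection (3 * k) k (PUnit : Type) K → K.IsStablyTrivial) → _root_.SmoothPoincare4) :=
  fun h' => h fun x => h' fun k _ K hK => x k K hK

/-- The truncations get weaker as `k₀` grows. [folklore] -/
theorem agkCor6SufficiencyUpTo_mono {k₀ k₁ : ℕ} (hk : k₀ ≤ k₁)
    (h : (∀ k ≤ k₀, ∀ K : TrisectionKernels (3 * k),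
        IsGroupTrisection (3 * k) k (PUnit : Type) K → K.IsStablyTrivial) → _root_.SmoothPoincare4) :
    (∀ k ≤ k₁, ∀ K : TrisectionKernels (3 * k),
        IsGroupTrisection (3 * k) k (PUnit : Type) K → K.IsStablyTrivial) → _root_.SmoothPoincare4 :=
  fun x => h fun k hk' K hK => x k (hk'.trans hk) K hK

/-- **The truncation at `k₀ = 0` IS the summit.**  (At `k₀ = 1` the hypothesis — every `(3,1)`
group trisection of `{1}` is stably standard, i.e. every genus-`3`-trisected homotopy `4`-sphere is
`S⁴` after stabilisation — is open in print.) [folklore] -/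
theorem agkCor6SufficiencyUpTo_zero_iff_smoothPoincare4 :
    ((∀ k ≤ 0, ∀ K : TrisectionKernels (3 * k),
        IsGroupTrisection (3 * k) k (PUnit : Type) K → K.IsStablyTrivial) → _root_.SmoothPoincare4) ↔
      _root_.SmoothPoincare4 := by
  constructor
  · intro h
    refine h fun k hk K hK => ?_
    obtain rfl : k = 0 := Nat.le_zero.1 hk
    exact agkCondition_zero K hK
  · exact fun h _ => h

/-! ## 2. Normal form of a stable-triviality witness -/

/-- **Rank bookkeeping of a witness**: if the `n`-th stabilisation of a `(g,k)` trisection of `G`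
is isomorphic to the transported `m`-th stabilisation of `s4Kernels`, then `k + n = m + 1` (rank
of the `(0,1)` pairwise quotients), so the standard side's `m` is forced. [folklore] -/
theorem eq_of_isStablyTrivial_witness {g k : ℕ} {G : Type} [Group G] {K : TrisectionKernels g}
    (hK : IsGroupTrisection g k G K) {n m : ℕ} (h : 3 + 3 * m = g + 3 * n)
    (hiso : TrisectionKernels.Iso (K.stabilizeIter n) ((s4Kernels.stabilizeIter m).cast h)) :
    k + n = m + 1 := by
  have h₁ := isGroupTrisection_stabilizeIter hK n
  have h₂ := isGroupTrisection_cast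
    (Summit.SmoothPoincare4.SmoothPoincare4.Theorems.WaldhausenPairs.Negative.stabilizeIter_isGroupTrisection m) h
  obtain ⟨e⟩ := Iso.nonempty_pairQuotient_equiv hiso 0 1
  exact Summit.SmoothPoincare4.SmoothPoincare4.Theorems.WaldhausenPairs.Negative.IsFreeOfRank.rank_eq
    ((h₁.free_pairQuotient 0 1 (by decide)).of_mulEquiv e) (h₂.free_pairQuotient 0 1 (by decide))

/-- **One-existential normal form of `IsStablyTrivial` on group trisections**: a `(g,k)`
trisection `K` of any group is stably trivial iff for some `n` with `k + n ≥ 1` its `n`-th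
stabilisation is isomorphic to the transported `(k + n - 1)`-th stabilisation of `s4Kernels`.
(In the crux family `g = 3k` the genus side condition is automatic.) [folklore] -/
theorem isStablyTrivial_iff_exists {g k : ℕ} {G : Type} [Group G] {K : TrisectionKernels g}
    (hK : IsGroupTrisection g k G K) :
    K.IsStablyTrivial ↔ ∃ n : ℕ, 1 ≤ k + n ∧ ∃ h : 3 + 3 * (k + n - 1) = g + 3 * n,
      TrisectionKernels.Iso (K.stabilizeIter n) ((s4Kernels.stabilizeIter (k + n - 1)).cast h) := by
  constructor
  · rintro ⟨n, m, h, hiso⟩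
    have hk := eq_of_isStablyTrivial_witness hK h hiso
    obtain rfl : m = k + n - 1 := by omega
    exact ⟨n, by omega, h, hiso⟩
  · rintro ⟨n, -, h, hiso⟩
    exact ⟨n, k + n - 1, h, hiso⟩

/-- The crux-family case: a `(3k,k)` trisection of `{1}` is stably trivial iff some `n`-th
stabilisation (`k + n ≥ 1`) is isomorphic to the transported `(k+n-1)`-th stabilisation of
`s4Kernels` — the shape in which route CongruenceShadows consumes `X` (`n = 0`, `m = k - 1`). [folklore] -/
theorem isStablyTrivial_iff_exists_balanced {k : ℕ} {K : TrisectionKernels (3 * k)}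
    (hK : IsGroupTrisection (3 * k) k (PUnit : Type) K) :
    K.IsStablyTrivial ↔ ∃ n : ℕ, 1 ≤ k + n ∧ ∃ h : 3 + 3 * (k + n - 1) = 3 * k + 3 * n,
      TrisectionKernels.Iso (K.stabilizeIter n) ((s4Kernels.stabilizeIter (k + n - 1)).cast h) :=
  isStablyTrivial_iff_exists hK

end Summit.SmoothPoincare4.SmoothPoincare4.Theorems.AgkCor6Sufficiency.Negative

end
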